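import Mathlib.Topology.UnitInterval
import Mathlib.Analysis.SpecialFunctions.Pow.Real
import Mathlib.Analysis.SpecialFunctions.Pow.Continuity
import Mathlib.Analysis.SpecialFunctions.Sqrt
import HarnessLib

/-!
# Köhler-Schindler–Tassion, §5.1: the increasing homeomorphisms `f_N(x) = (1 - (1 - x)^{1/N})^N`
and their iterates (proofs only)

Topic `Literature/Probability/Percolation`; sibling of `KohlerSchindlerTassionRSW.lean` (the named
fact `KohlerSchindlerTassion2023_thm1`, Theorem 1 of [KohlerSchindlerTassion2023], and its corrected
nearest-neighbour restatement). This file and `KohlerSchindlerTassionRSWScheme.lean` formalise §5 of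
the paper — "Proof of Theorem 1 based on Lemmas 1–5 and their corresponding dual results" — as a
stand-alone, fully proved reduction; this file is the real-analysis toolkit (§5.1 "Increasing
homeomorphisms"), the scheme file is §5.2. No measure theory here.

## Source (arXiv:2011.04618 = Duke Math. J. 172 (2023), §3 Lemma 1 and §5.1)

Lemma 1 of the paper bounds long crossings by bridges through `f_1(x) := (1 - (1 - x)^{1/2000})^{2000}`
("Set `f_1(x) := (1-(1-x)^{1/2000})^{2000}`. For all `n ≥ 1`, (i) `P[𝓒(8n,n)] ≥ f_1(b(n))`, (ii)
`a(n) ≥ f_1(P[𝓒(n,8n)])`, (iii) …"), and §5.1 introduces "increasing homeomorphisms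
`f_i : [0,1] → [0,1]`, `f_i(x) = (1 - (1 - x)^{1/2000^i})^{2000^i}`" with the elementary properties
(10) `f_i ≥ √f_{i+1}`, (11) `x ≥ f_i(1 - y) ⇔ y ≥ f_i(1 - x)` ("which follows from the fact that
`(1 - f_i) ∘ (1 - f_i) = id`"), (12) `f_i ∘ f_i ≥ f_{2i}` and the composite estimate (13).

## What is here (namespace `Literature.Probability.Percolation.KST2023`)

* `KST2023.rootPow N : ℝ → ℝ` — the function `f_N(x) = (1 - (1 - x)^{1/N})^N` on `[0, 1]` (the paper's
  `f_1` is `rootPow 2000`, its `f_i` is `rootPow (2000^i)`), extended to `ℝ` by clamping the argument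
  to `[0, 1]`; `KST2023.rootPowHomeo N : unitInterval ≃ₜ unitInterval` — the same map as a
  homeomorphism of `[0, 1]` with the explicit inverse `y ↦ 1 - (1 - y^{1/N})^N` (this is the printed
  identity `(1 - f) ∘ (1 - f) = id` behind (11)).
* `KST2023.IsAdmissible g` — the four properties of `g = f_N` (`N ≥ 2`) that §5.2 actually consumes:
  `g` is monotone, `g 0 = 0`, the duality (11) in the one-directional form
  `g (1 - y) ≤ x → g (1 - x) ≤ y` on `[0,1]²`, and `g x ≤ x²` on `[0, 1]`
  (`KST2023.isAdmissible_rootPow`). PROVED consequences: `g t ≤ 1 - √(1 - t)` and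
  `1 - t ≤ (1 - g t)²` (the inequalities the paper uses in the forms "`f(t) ≤ 1 - (1-t)^{1/2}`" and
  "`1 - (1 - y)² ≤ f_1⁻¹(y)`"), and for the ITERATES `g^[k]`: admissibility, `g^[k+1] ≤ (g^[k])²`
  (the replacement of (10)), `g^[k] x ≤ x^{2^k}`, `1 - x ≤ (1 - g^[k] x)^{2^k}`, antitonicity in `k`,
  duality (11) for every `g^[k]`.
* `KST2023.rootPow_one_sub_pow_le` — `f_N(1 - ε^j) ≤ (1 - ε)^i` for `i, j ≤ N`: the computation behind
  "the scale `m_0` is well-defined since `b(1) ≥ f_1(1 - b*(1))`. To see this, just observe that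
  `b(1) ≥ p²` and `b*(1) ≥ (1-p)³`" (§5.2).
* `KST2023.iterHomeo G k` — the `k`-fold iterate of a self-homeomorphism (the universal homeomorphism
  `ψ_ρ` of Theorem 1 is, in the scheme file, an iterate of `rootPowHomeo N`).

## Design choice (a documented deviation from the printed bookkeeping)

The paper works with the family `f_i = rootPow (2000^i)` and needs the comparison (12)
`f_i ∘ f_i ≥ f_{2i}` (an inequality `(1-(1-x)^{1/a})^a ≤ 1-(1-x^a)^{1/a}` proved "by elementary means
using the change of variable `x' = (1-x)^{1/a}`") and the composite bound (13). The scheme file runs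
the SAME induction with the compositional iterates `F_k := f_1^[k]` instead, for which
`F_j ∘ F_k = F_{j+k}` holds by definition, so (12)–(13) are not needed and are not vendored; (10) is
replaced by `F_{k+1} ≤ F_k²` (`IsAdmissible.iterate_succ_le_sq`). Only the constants of Theorem 1's
(anyway inexplicit) homeomorphism change. Everything in this file is proved; nothing is a named fact.

## References

* [KohlerSchindlerTassion2023] L. Köhler-Schindler, V. Tassion, *Crossing probabilities for planar
  percolation*, Duke Math. J. 172 (2023) 809–838 (arXiv:2011.04618), §3 Lemma 1, §5.1 (10)–(13), §5.2.
-/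

namespace Literature.Probability.Percolation

namespace KST2023

open Set

noncomputable section

/-! ### Admissible bookkeeping functions and their iterates -/

/-- The properties of the paper's `f_1` (more generally of `f_N = rootPow N`, `N ≥ 2`) used by the
renormalisation scheme of §5.2: `g` is monotone with `g 0 = 0`, satisfies the duality (11)
"`x ≥ f(1 - y) ⇔ y ≥ f(1 - x)`" (one direction suffices, the other follows by symmetry) on `[0,1]²`,
and `g x ≤ x²` on `[0, 1]` (for `f_N`: `f_N(x) ≤ x^N`). [cite: KohlerSchindlerTassion2023, §5.1 (11)] -/
structure IsAdmissible (g : ℝ → ℝ) : Prop where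
  /-- `g` is non-decreasing. -/
  mono : Monotone g
  /-- `g 0 = 0`. -/
  map_zero : g 0 = 0
  /-- Duality (11): `g (1 - y) ≤ x → g (1 - x) ≤ y` for `x, y ∈ [0, 1]`. -/
  dual : ∀ ⦃x y : ℝ⦄, x ∈ Icc (0 : ℝ) 1 → y ∈ Icc (0 : ℝ) 1 → g (1 - y) ≤ x → g (1 - x) ≤ y
  /-- `g x ≤ x²` on `[0, 1]`. -/
  le_sq : ∀ ⦃x : ℝ⦄, x ∈ Icc (0 : ℝ) 1 → g x ≤ x ^ 2

namespace IsAdmissible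

variable {g : ℝ → ℝ} (h : IsAdmissible g)
include h

/-- `g ≥ 0` on `[0, ∞)`. [folklore] -/
theorem nonneg {x : ℝ} (hx : 0 ≤ x) : 0 ≤ g x := h.map_zero ▸ h.mono hx

/-- `g x ≤ x` on `[0, 1]`. [folklore] -/
theorem le_self {x : ℝ} (hx : x ∈ Icc (0 : ℝ) 1) : g x ≤ x :=
  (h.le_sq hx).trans (by nlinarith [hx.1, hx.2])

/-- `g x ≤ 1` on `[0, 1]`. [folklore] -/
theorem le_one {x : ℝ} (hx : x ∈ Icc (0 : ℝ) 1) : g x ≤ 1 := (h.le_self hx).trans hx.2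

/-- `g` maps `[0, 1]` into itself. [folklore] -/
theorem mem_Icc {x : ℝ} (hx : x ∈ Icc (0 : ℝ) 1) : g x ∈ Icc (0 : ℝ) 1 :=
  ⟨h.nonneg hx.1, h.le_one hx⟩

/-- The iterates `g^[k+1]` are admissible (duality (11) passes to compositional powers because they
commute). [cite: KohlerSchindlerTassion2023, §5.1 (11)] -/
theorem iterate_succ (k : ℕ) : IsAdmissible (g^[k + 1]) := by
  induction k with
  | zero => simpa using h
  | succ k ih =>
    refine ⟨?_, ?_, ?_, ?_⟩
    · rw [Function.iterate_succ']
      exact h.mono.comp ih.mono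
    · rw [Function.iterate_succ', Function.comp_apply, ih.map_zero, h.map_zero]
    · intro x y hx hy hxy
      rw [Function.iterate_succ', Function.comp_apply] at hxy ⊢
      have hG := ih.mem_Icc (x := 1 - y) ⟨by linarith [hy.2], by linarith [hy.1]⟩
      have h1 : g (1 - (1 - g^[k + 1] (1 - y))) ≤ x := by rwa [sub_sub_cancel]
      have h2 := h.dual hx ⟨by linarith [hG.2], by linarith [hG.1]⟩ h1
      have h3 : g^[k + 1] (1 - y) ≤ 1 - g (1 - x) := by linarith
      have hgx := h.mem_Icc (x := 1 - x) ⟨by linarith [hx.2], by linarith [hx.1]⟩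
      have h4 := ih.dual ⟨by linarith [hgx.2], by linarith [hgx.1]⟩ hy h3
      rw [sub_sub_cancel] at h4
      rwa [← Function.iterate_succ_apply, Function.iterate_succ_apply'] at h4
    · intro x hx
      rw [Function.iterate_succ', Function.comp_apply]
      have hG := ih.mem_Icc hx
      exact (h.le_sq hG).trans (pow_le_pow_left₀ hG.1 (ih.le_self hx) 2)

/-- The iterates map `[0, 1]` into itself. [folklore] -/
theorem iterate_mem_Icc (k : ℕ) {x : ℝ} (hx : x ∈ Icc (0 : ℝ) 1) : g^[k] x ∈ Icc (0 : ℝ) 1 := by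
  cases k with
  | zero => exact hx
  | succ k => exact (h.iterate_succ k).mem_Icc hx

/-- The iterates are monotone. [folklore] -/
theorem iterate_mono (k : ℕ) : Monotone (g^[k]) := h.mono.iterate k

/-- `g^[k+1] x ≤ (g^[k] x)²` on `[0, 1]` — the scheme's replacement of (10) `f_i ≥ √f_{i+1}`.
[cite: KohlerSchindlerTassion2023, §5.1 (10)] -/
theorem iterate_succ_le_sq (k : ℕ) {x : ℝ} (hx : x ∈ Icc (0 : ℝ) 1) :
    g^[k + 1] x ≤ (g^[k] x) ^ 2 := by
  rw [Function.iterate_succ_apply']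
  exact h.le_sq (h.iterate_mem_Icc k hx)

/-- `g^[k+1] ≤ g^[k]` on `[0, 1]`. [folklore] -/
theorem iterate_succ_le (k : ℕ) {x : ℝ} (hx : x ∈ Icc (0 : ℝ) 1) : g^[k + 1] x ≤ g^[k] x := by
  rw [Function.iterate_succ_apply']
  exact h.le_self (h.iterate_mem_Icc k hx)

/-- The iterates decrease with the number of iterations: `g^[l] ≤ g^[k]` on `[0, 1]` for `k ≤ l` (the
paper's "`f_i ≥ f_j` for `i ≤ j`"). [cite: KohlerSchindlerTassion2023, §5.1] -/
theorem iterate_le_iterate {k l : ℕ} (hkl : k ≤ l) {x : ℝ} (hx : x ∈ Icc (0 : ℝ) 1) :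
    g^[l] x ≤ g^[k] x := by
  induction l, hkl using Nat.le_induction with
  | base => exact le_rfl
  | succ l _ ih => exact (h.iterate_succ_le l hx).trans ih

/-- `g^[k] x ≤ x^{2^k}` on `[0, 1]`. [folklore] -/
theorem iterate_le_pow (k : ℕ) {x : ℝ} (hx : x ∈ Icc (0 : ℝ) 1) : g^[k] x ≤ x ^ (2 ^ k) := by
  induction k with
  | zero => simp
  | succ k ih =>
    calc g^[k + 1] x ≤ (g^[k] x) ^ 2 := h.iterate_succ_le_sq k hx
      _ ≤ (x ^ (2 ^ k)) ^ 2 := pow_le_pow_left₀ (h.iterate_mem_Icc k hx).1 ih 2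
      _ = x ^ (2 ^ (k + 1)) := by rw [← pow_mul, pow_succ]

/-- `g t ≤ 1 - √(1 - t)` on `[0, 1]` (from (11) and `g x ≤ x²` at `x = √(1-t)`; the paper uses it as
"`1 - (1 - f_2(y))^{1/2} ≥ f_2(f_2(y))`"). [cite: KohlerSchindlerTassion2023, §5.2] -/
theorem le_one_sub_sqrt {t : ℝ} (ht : t ∈ Icc (0 : ℝ) 1) : g t ≤ 1 - Real.sqrt (1 - t) := by
  have hs : Real.sqrt (1 - t) ∈ Icc (0 : ℝ) 1 :=
    ⟨Real.sqrt_nonneg _, Real.sqrt_le_one.mpr (by linarith [ht.1])⟩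
  have h1 : g (1 - (1 - Real.sqrt (1 - t))) ≤ 1 - t := by
    rw [sub_sub_cancel]
    calc g (Real.sqrt (1 - t)) ≤ Real.sqrt (1 - t) ^ 2 := h.le_sq hs
      _ = 1 - t := Real.sq_sqrt (by linarith [ht.2])
  have h2 := h.dual (x := 1 - t) (y := 1 - Real.sqrt (1 - t)) ⟨by linarith [ht.2], by linarith [ht.1]⟩
    ⟨by linarith [hs.2], by linarith [hs.1]⟩ h1
  rwa [sub_sub_cancel] at h2

/-- `√(1 - t) ≤ 1 - g t` on `[0, 1]`. [folklore] -/
theorem sqrt_le_one_sub {t : ℝ} (ht : t ∈ Icc (0 : ℝ) 1) : Real.sqrt (1 - t) ≤ 1 - g t := by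
  linarith [h.le_one_sub_sqrt ht]

/-- `1 - t ≤ (1 - g t)²` on `[0, 1]` — the inverse-free form of the paper's
"`1 - (1 - y)² ≤ 1 - (1 - y^{1/2000})^{2000} = f_1⁻¹(y)`". [cite: KohlerSchindlerTassion2023, §5.1 (13)] -/
theorem one_sub_le_sq {t : ℝ} (ht : t ∈ Icc (0 : ℝ) 1) : 1 - t ≤ (1 - g t) ^ 2 := by
  calc 1 - t = Real.sqrt (1 - t) ^ 2 := (Real.sq_sqrt (by linarith [ht.2])).symm
    _ ≤ (1 - g t) ^ 2 := pow_le_pow_left₀ (Real.sqrt_nonneg _) (h.sqrt_le_one_sub ht) 2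

/-- `1 - x ≤ (1 - g^[k] x)^{2^k}` on `[0, 1]`. [folklore] -/
theorem one_sub_le_pow_iterate (k : ℕ) {x : ℝ} (hx : x ∈ Icc (0 : ℝ) 1) :
    1 - x ≤ (1 - g^[k] x) ^ (2 ^ k) := by
  induction k with
  | zero => simp
  | succ k ih =>
    have hk := h.iterate_mem_Icc k hx
    calc 1 - x ≤ (1 - g^[k] x) ^ (2 ^ k) := ih
      _ ≤ ((1 - g^[k + 1] x) ^ 2) ^ (2 ^ k) := by
          refine pow_le_pow_left₀ (by linarith [hk.2]) ?_ _
          rw [Function.iterate_succ_apply']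
          exact h.one_sub_le_sq hk
      _ = (1 - g^[k + 1] x) ^ (2 ^ (k + 1)) := by rw [← pow_mul, pow_succ']

/-- `g^[k+1] x ≤ 1 - √(1 - g^[k] x)` on `[0, 1]`. [folklore] -/
theorem iterate_succ_le_one_sub_sqrt (k : ℕ) {x : ℝ} (hx : x ∈ Icc (0 : ℝ) 1) :
    g^[k + 1] x ≤ 1 - Real.sqrt (1 - g^[k] x) := by
  rw [Function.iterate_succ_apply']
  exact h.le_one_sub_sqrt (h.iterate_mem_Icc k hx)

/-- Duality (11) for every iterate: `g^[k] (1 - y) ≤ x → g^[k] (1 - x) ≤ y` on `[0, 1]²`.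
[cite: KohlerSchindlerTassion2023, §5.1 (11)] -/
theorem iterate_dual (k : ℕ) {x y : ℝ} (hx : x ∈ Icc (0 : ℝ) 1) (hy : y ∈ Icc (0 : ℝ) 1)
    (hxy : g^[k] (1 - y) ≤ x) : g^[k] (1 - x) ≤ y := by
  cases k with
  | zero => simp only [Function.iterate_zero, id_eq] at hxy ⊢; linarith
  | succ k => exact (h.iterate_succ k).dual hx hy hxy

end IsAdmissible

/-! ### The functions `f_N(x) = (1 - (1 - x)^{1/N})^N` -/

/-- The function `f_N(x) = (1 - (1 - x)^{1/N})^N` of Köhler-Schindler–Tassion (§3, Lemma 1: `f_1` with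
`N = 2000`; §5.1: `f_i` with `N = 2000^i`) on `[0, 1]`, extended to `ℝ` by clamping the argument to
`[0, 1]` (so that it is globally monotone). [cite: KohlerSchindlerTassion2023, §5.1] -/
def rootPow (N : ℕ) (x : ℝ) : ℝ :=
  (1 - (1 - (projIcc (0 : ℝ) 1 zero_le_one x : ℝ)) ^ ((N : ℝ)⁻¹)) ^ N

/-- `rootPow` on `[0, 1]`, unfolded. [cite: KohlerSchindlerTassion2023, §5.1] -/
theorem rootPow_of_mem (N : ℕ) {x : ℝ} (hx : x ∈ Icc (0 : ℝ) 1) :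
    rootPow N x = (1 - (1 - x) ^ ((N : ℝ)⁻¹)) ^ N := by
  rw [rootPow, projIcc_of_mem zero_le_one hx]

/-- `rootPow` only depends on the argument clamped to `[0, 1]`. [folklore] -/
theorem rootPow_eq_projIcc (N : ℕ) (x : ℝ) :
    rootPow N x = rootPow N (projIcc (0 : ℝ) 1 zero_le_one x) := by
  rw [rootPow_of_mem N (projIcc (0 : ℝ) 1 zero_le_one x).2, rootPow]

/-- `1 - (1 - t)^{1/N} ∈ [0, 1]` for `t ∈ [0, 1]`. [folklore] -/
theorem one_sub_rpow_mem {t : ℝ} (ht : t ∈ Icc (0 : ℝ) 1) (N : ℕ) :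
    1 - (1 - t) ^ ((N : ℝ)⁻¹) ∈ Icc (0 : ℝ) 1 := by
  have h0 : 0 ≤ 1 - t := by linarith [ht.2]
  have h1 : 1 - t ≤ 1 := by linarith [ht.1]
  have he : 0 ≤ ((N : ℝ)⁻¹) := by positivity
  constructor
  · linarith [Real.rpow_le_one h0 h1 he]
  · linarith [Real.rpow_nonneg h0 ((N : ℝ)⁻¹)]

/-- `rootPow N` takes values in `[0, 1]`. [folklore] -/
theorem rootPow_mem_Icc (N : ℕ) (x : ℝ) : rootPow N x ∈ Icc (0 : ℝ) 1 := by
  rw [rootPow_eq_projIcc, rootPow_of_mem N (projIcc (0 : ℝ) 1 zero_le_one x).2]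
  have h := one_sub_rpow_mem (projIcc (0 : ℝ) 1 zero_le_one x).2 N
  exact ⟨pow_nonneg h.1 N, pow_le_one₀ h.1 h.2⟩

/-- `rootPow N` is monotone ("increasing homeomorphisms"). [cite: KohlerSchindlerTassion2023, §5.1] -/
theorem rootPow_monotone (N : ℕ) : Monotone (rootPow N) := by
  intro x y hxy
  rw [rootPow_eq_projIcc N x, rootPow_eq_projIcc N y,
    rootPow_of_mem N (projIcc (0 : ℝ) 1 zero_le_one x).2,
    rootPow_of_mem N (projIcc (0 : ℝ) 1 zero_le_one y).2]
  have hc : (projIcc (0 : ℝ) 1 zero_le_one x : ℝ) ≤ projIcc (0 : ℝ) 1 zero_le_one y :=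
    monotone_projIcc zero_le_one hxy
  have hx := (projIcc (0 : ℝ) 1 zero_le_one x).2
  have hy := (projIcc (0 : ℝ) 1 zero_le_one y).2
  have he : 0 ≤ ((N : ℝ)⁻¹) := by positivity
  refine pow_le_pow_left₀ (one_sub_rpow_mem hx N).1 ?_ N
  have : (1 - (projIcc (0 : ℝ) 1 zero_le_one y : ℝ)) ^ ((N : ℝ)⁻¹) ≤
      (1 - (projIcc (0 : ℝ) 1 zero_le_one x : ℝ)) ^ ((N : ℝ)⁻¹) :=
    Real.rpow_le_rpow (by linarith [hy.2]) (by linarith) he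
  linarith

/-- `f_N(0) = 0` (`N ≠ 0`). [cite: KohlerSchindlerTassion2023, §5.1] -/
theorem rootPow_zero {N : ℕ} (hN : N ≠ 0) : rootPow N 0 = 0 := by
  rw [rootPow_of_mem N ⟨le_rfl, zero_le_one⟩, sub_zero, Real.one_rpow, sub_self, zero_pow hN]

/-- `f_N(1) = 1` (`N ≠ 0`). [cite: KohlerSchindlerTassion2023, §5.1] -/
theorem rootPow_one {N : ℕ} (hN : N ≠ 0) : rootPow N 1 = 1 := by
  rw [rootPow_of_mem N ⟨zero_le_one, le_rfl⟩, sub_self,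
    Real.zero_rpow (inv_ne_zero (Nat.cast_ne_zero.mpr hN)), sub_zero, one_pow]

/-- `f_N(1 - y) = (1 - y^{1/N})^N` on `[0, 1]`. [cite: KohlerSchindlerTassion2023, §5.1 (11)] -/
theorem rootPow_one_sub {N : ℕ} {y : ℝ} (hy : y ∈ Icc (0 : ℝ) 1) :
    rootPow N (1 - y) = (1 - y ^ ((N : ℝ)⁻¹)) ^ N := by
  rw [rootPow_of_mem N ⟨by linarith [hy.2], by linarith [hy.1]⟩, sub_sub_cancel]

/-- Duality (11) for `f_N`: `f_N(1 - y) ≤ x → f_N(1 - x) ≤ y` on `[0, 1]²` ("which follows from the fact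
that `(1 - f_i) ∘ (1 - f_i) = id`"). [cite: KohlerSchindlerTassion2023, §5.1 (11)] -/
theorem rootPow_dual {N : ℕ} (hN : N ≠ 0) {x y : ℝ} (hx : x ∈ Icc (0 : ℝ) 1) (hy : y ∈ Icc (0 : ℝ) 1)
    (hxy : rootPow N (1 - y) ≤ x) : rootPow N (1 - x) ≤ y := by
  rw [rootPow_one_sub hy] at hxy
  rw [rootPow_one_sub hx]
  have he : 0 ≤ ((N : ℝ)⁻¹) := by positivity
  have ha : 0 ≤ 1 - y ^ ((N : ℝ)⁻¹) := by linarith [Real.rpow_le_one hy.1 hy.2 he]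
  have hb : 0 ≤ 1 - x ^ ((N : ℝ)⁻¹) := by linarith [Real.rpow_le_one hx.1 hx.2 he]
  have h1 : 1 - y ^ ((N : ℝ)⁻¹) ≤ x ^ ((N : ℝ)⁻¹) := by
    calc 1 - y ^ ((N : ℝ)⁻¹) = ((1 - y ^ ((N : ℝ)⁻¹)) ^ N) ^ ((N : ℝ)⁻¹) :=
          (Real.pow_rpow_inv_natCast ha hN).symm
      _ ≤ x ^ ((N : ℝ)⁻¹) := Real.rpow_le_rpow (pow_nonneg ha N) hxy he
  calc (1 - x ^ ((N : ℝ)⁻¹)) ^ N ≤ (y ^ ((N : ℝ)⁻¹)) ^ N :=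
        pow_le_pow_left₀ hb (by linarith) N
    _ = y := Real.rpow_inv_natCast_pow hy.1 hN

/-- `f_N(x) ≤ x^N` on `[0, 1]` (since `1 - (1-x)^{1/N} ≤ x`). [folklore] -/
theorem rootPow_le_pow {N : ℕ} (hN : N ≠ 0) {x : ℝ} (hx : x ∈ Icc (0 : ℝ) 1) :
    rootPow N x ≤ x ^ N := by
  rw [rootPow_of_mem N hx]
  have he1 : ((N : ℝ)⁻¹) ≤ 1 :=
    inv_le_one_of_one_le₀ (by exact_mod_cast Nat.one_le_iff_ne_zero.mpr hN)
  have h1 : 1 - x ≤ (1 - x) ^ ((N : ℝ)⁻¹) :=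
    Real.self_le_rpow_of_le_one (by linarith [hx.2]) (by linarith [hx.1]) he1
  exact pow_le_pow_left₀ (one_sub_rpow_mem hx N).1 (by linarith) N

/-- `f_N(x) ≤ x²` on `[0, 1]` for `N ≥ 2`. [folklore] -/
theorem rootPow_le_sq {N : ℕ} (hN : 2 ≤ N) {x : ℝ} (hx : x ∈ Icc (0 : ℝ) 1) :
    rootPow N x ≤ x ^ 2 :=
  (rootPow_le_pow (by omega) hx).trans (pow_le_pow_of_le_one hx.1 hx.2 hN)

/-- **`f_N` is admissible for `N ≥ 2`** (in particular the paper's `f_1 = rootPow 2000`).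
[cite: KohlerSchindlerTassion2023, §5.1 (11)] -/
theorem isAdmissible_rootPow {N : ℕ} (hN : 2 ≤ N) : IsAdmissible (rootPow N) where
  mono := rootPow_monotone N
  map_zero := rootPow_zero (by omega)
  dual _ _ hx hy hxy := rootPow_dual (by omega) hx hy hxy
  le_sq _ hx := rootPow_le_sq hN hx

/-- **The scale-one estimate**: `f_N(1 - ε^j) ≤ (1 - ε)^i` for `ε ∈ [0, 1]`, `1 ≤ j ≤ N`, `i ≤ N` — with
`ε = 1 - p` this is the computation "`b(1) ≥ p²` and `b*(1) ≥ (1-p)³`" `⇒ b(1) ≥ f(1 - b*(1))` that makes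
the scale `m_0` well-defined. [cite: KohlerSchindlerTassion2023, §5.2] -/
theorem rootPow_one_sub_pow_le {N i j : ℕ} (hi : i ≤ N) (hj : j ≤ N) (hj0 : j ≠ 0) {ε : ℝ}
    (hε : ε ∈ Icc (0 : ℝ) 1) : rootPow N (1 - ε ^ j) ≤ (1 - ε) ^ i := by
  have hN : N ≠ 0 := by omega
  have hεj : ε ^ j ∈ Icc (0 : ℝ) 1 := ⟨pow_nonneg hε.1 j, pow_le_one₀ hε.1 hε.2⟩
  rw [rootPow_one_sub hεj]
  have h1 : ε ≤ (ε ^ j) ^ ((N : ℝ)⁻¹) := by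
    rw [← Real.rpow_natCast, ← Real.rpow_mul hε.1]
    refine Real.self_le_rpow_of_le_one hε.1 hε.2 ?_
    rw [← div_eq_mul_inv, div_le_one (by exact_mod_cast Nat.pos_of_ne_zero hN)]
    exact_mod_cast hj
  have h2 : 0 ≤ 1 - (ε ^ j) ^ ((N : ℝ)⁻¹) := by
    linarith [Real.rpow_le_one hεj.1 hεj.2 (by positivity : 0 ≤ ((N : ℝ)⁻¹))]
  calc (1 - (ε ^ j) ^ ((N : ℝ)⁻¹)) ^ N ≤ (1 - ε) ^ N := pow_le_pow_left₀ h2 (by linarith) N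
    _ ≤ (1 - ε) ^ i := pow_le_pow_of_le_one (by linarith [hε.2]) (by linarith [hε.1]) hi

/-- The iterated scale-one estimate: `f_N^[k+1](1 - ε^j) ≤ (1 - ε)^i` whenever `1 ≤ j ≤ N` and
`i ≤ N · 2^k` (so the admissible exponent `i` grows with the number of iterations). [folklore] -/
theorem iterate_rootPow_one_sub_pow_le {N i j k : ℕ} (hN : 2 ≤ N) (hi : i ≤ N * 2 ^ k) (hj : j ≤ N)
    (hj0 : j ≠ 0) {ε : ℝ} (hε : ε ∈ Icc (0 : ℝ) 1) :
    (rootPow N)^[k + 1] (1 - ε ^ j) ≤ (1 - ε) ^ i := by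
  have hε' : 1 - ε ∈ Icc (0 : ℝ) 1 := ⟨by linarith [hε.2], by linarith [hε.1]⟩
  have hpN : (1 - ε) ^ N ∈ Icc (0 : ℝ) 1 := ⟨pow_nonneg hε'.1 N, pow_le_one₀ hε'.1 hε'.2⟩
  calc (rootPow N)^[k + 1] (1 - ε ^ j) = (rootPow N)^[k] (rootPow N (1 - ε ^ j)) :=
        Function.iterate_succ_apply _ k _
    _ ≤ (rootPow N)^[k] ((1 - ε) ^ N) :=
        (isAdmissible_rootPow hN).iterate_mono k (rootPow_one_sub_pow_le le_rfl hj hj0 hε)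
    _ ≤ ((1 - ε) ^ N) ^ (2 ^ k) := (isAdmissible_rootPow hN).iterate_le_pow k hpN
    _ = (1 - ε) ^ (N * 2 ^ k) := by rw [← pow_mul]
    _ ≤ (1 - ε) ^ i := pow_le_pow_of_le_one hε'.1 hε'.2 hi

/-! ### `f_N` as a homeomorphism of `[0, 1]`, and iterates of homeomorphisms -/

/-- `f_N` as a self-homeomorphism of `unitInterval` (`N ≠ 0`), with the explicit inverse
`f_N⁻¹(y) = 1 - (1 - y^{1/N})^N` — the identity `(1 - f_N) ∘ (1 - f_N) = id` of the paper
("increasing homeomorphisms `f_i : [0,1] → [0,1]`"). [cite: KohlerSchindlerTassion2023, §5.1 (11)] -/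
def rootPowHomeo (N : ℕ) (hN : N ≠ 0) : unitInterval ≃ₜ unitInterval where
  toFun x := ⟨(1 - (1 - (x : ℝ)) ^ ((N : ℝ)⁻¹)) ^ N, by
    have h := one_sub_rpow_mem x.2 N
    exact ⟨pow_nonneg h.1 N, pow_le_one₀ h.1 h.2⟩⟩
  invFun y := ⟨1 - (1 - (y : ℝ) ^ ((N : ℝ)⁻¹)) ^ N, by
    have he : 0 ≤ ((N : ℝ)⁻¹) := by positivity
    have h0 : 0 ≤ 1 - (y : ℝ) ^ ((N : ℝ)⁻¹) := by linarith [Real.rpow_le_one y.2.1 y.2.2 he]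
    have h1 : 1 - (y : ℝ) ^ ((N : ℝ)⁻¹) ≤ 1 := by linarith [Real.rpow_nonneg y.2.1 ((N : ℝ)⁻¹)]
    constructor
    · linarith [pow_le_one₀ h0 h1 (n := N)]
    · linarith [pow_nonneg h0 N]⟩
  left_inv x := by
    ext
    have h0 : 0 ≤ 1 - (x : ℝ) := by linarith [x.2.2]
    have h := one_sub_rpow_mem x.2 N
    simp only
    rw [Real.pow_rpow_inv_natCast h.1 hN, sub_sub_cancel, Real.rpow_inv_natCast_pow h0 hN,
      sub_sub_cancel]
  right_inv y := by
    ext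
    have he : 0 ≤ ((N : ℝ)⁻¹) := by positivity
    have h0 : 0 ≤ 1 - (y : ℝ) ^ ((N : ℝ)⁻¹) := by linarith [Real.rpow_le_one y.2.1 y.2.2 he]
    simp only
    rw [sub_sub_cancel, Real.pow_rpow_inv_natCast h0 hN, sub_sub_cancel,
      Real.rpow_inv_natCast_pow y.2.1 hN]
  continuous_toFun := by
    have he : 0 ≤ ((N : ℝ)⁻¹) := by positivity
    refine Continuous.subtype_mk ?_ _
    exact ((continuous_const.sub ((continuous_const.sub continuous_subtype_val).rpow_const
      fun _ => Or.inr he)).pow N)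
  continuous_invFun := by
    have he : 0 ≤ ((N : ℝ)⁻¹) := by positivity
    refine Continuous.subtype_mk ?_ _
    exact continuous_const.sub ((continuous_const.sub (continuous_subtype_val.rpow_const
      fun _ => Or.inr he)).pow N)

/-- `rootPowHomeo N` is `rootPow N` on `[0, 1]`. [folklore] -/
theorem coe_rootPowHomeo {N : ℕ} (hN : N ≠ 0) (x : unitInterval) :
    (rootPowHomeo N hN x : ℝ) = rootPow N x := by
  rw [rootPow_of_mem N x.2]
  rfl

/-- The `k`-fold iterate `G ∘ ⋯ ∘ G` of a self-homeomorphism, as a homeomorphism. [folklore] -/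
def iterHomeo {X : Type*} [TopologicalSpace X] (G : X ≃ₜ X) : ℕ → X ≃ₜ X
  | 0 => Homeomorph.refl X
  | k + 1 => (iterHomeo G k).trans G

/-- `iterHomeo G k` is the function iterate `G^[k]`. [folklore] -/
theorem coe_iterHomeo {X : Type*} [TopologicalSpace X] (G : X ≃ₜ X) (k : ℕ) :
    ⇑(iterHomeo G k) = (⇑G)^[k] := by
  induction k with
  | zero => rfl
  | succ k ih =>
    rw [Function.iterate_succ']
    change ⇑G ∘ ⇑(iterHomeo G k) = _
    rw [ih]

/-- `iterHomeo G k x = G^[k] x`. [folklore] -/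
theorem iterHomeo_apply {X : Type*} [TopologicalSpace X] (G : X ≃ₜ X) (k : ℕ) (x : X) :
    iterHomeo G k x = (⇑G)^[k] x := by
  rw [coe_iterHomeo]

/-- If the homeomorphism `G` of `[0, 1]` is the restriction of `g : ℝ → ℝ`, then `iterHomeo G k` is the
restriction of `g^[k]`. [folklore] -/
theorem coe_iterHomeo_apply_eq {g : ℝ → ℝ} (G : unitInterval ≃ₜ unitInterval)
    (hG : ∀ x : unitInterval, (G x : ℝ) = g x) (k : ℕ) (x : unitInterval) :
    ((iterHomeo G k x : unitInterval) : ℝ) = g^[k] x := by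
  induction k generalizing x with
  | zero => rfl
  | succ k ih =>
    rw [iterHomeo_apply, Function.iterate_succ_apply', Function.iterate_succ_apply', hG,
      ← iterHomeo_apply, ih]

end

end KST2023

end Literature.Probability.Percolation
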